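import Summits.HodgeConjecture.HodgeConjecture.Theorems.R90S6TorusFixedSpecialCountTwoCongruentClosed   -- ★ FILE 1 (p864751) HEAD `natCard_fixedBy_special_eq_one_add_mul_natCard_fixedBy_of_mem_adjoin`, §5 `finite_fixedBy_of_mem_adjoin_singleton`; brings ★ T2
import Summits.HodgeConjecture.HodgeConjecture.Theorems.R90S6FlickerLiteralShiftAdjoin               -- FILE 2 sibling B: `adjoin_letters_of_shift_mid∕last`, `shift_scalar_letters`, §1 helpers; brings sibling A (`exists_unitary_coe_eq_flickerLiteral_one∕pi`, `exists_normOne_shift`) and ★ p09 Regimes letters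
import Literature.NumberTheory.Rogawski1990.UnitOrbitalIntegralInertValueThetaZeroTrichotomy            -- ★ CORNER `natCard_fixedPoints_unitaryInt_corner_eq_phiZero` (via …Corner), ★ `add_sub_two_mul_ne_zero_of_normOne`
import Literature.NumberTheory.Rogawski1990.UnitOrbitalIntegralInertValueThetaOneCorner                 -- ★ CORNER `natCard_fixedPoints_unitaryInt_corner_eq_phiOne`
import Literature.NumberTheory.Automorphic.UnitaryFixedCosetsStableLattices                              -- ★ `unitaryInt_eq_glInt_subgroupOf`
import HarnessLib

/-!
# R90 · S6 — LINE S1, REGIME R-II, CARD R2M (FILE 2): THE FIXED SPECIAL COUNT `a₁` OF THE FOUR FLICKER LITERALS WITH `a ≡ b (ϖⁿ)`, `c` SEPARATED —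
# `a₁(t₁) = 1 + q·φ₀(n−1, 0, 0)`, `a₁(t₃) = 1 + q·φ₁(0, n−1)`, `a₁(t₂) = a₁(t₄) = 1` (`Theorems/R90S6TorusFixedSpecialCountTwoCongruentFlicker.lean`)

Cell `hodgecm-mathlib`, crux H413 (`stmt-HodgeConjecture-24833`), route of record `HCCMUnconditional`; programme R90-TF, section S6 (base `R90-C14`), seat R90-C14-p05 (g2);
S6 dealer R90-C14-plan (g2) card R2M (2026-09-05T02:23:40Z), two-file cut «=» 02:31:48Z, head shapes (3a)–(3d) «=» 02:47:13Z; consumer GF1 FILE 2 (K2Liu-p14 (g5)) ∕ the (E1)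
sheet of typ1 (g3).  Helper lane `--supports stmt-HodgeConjecture-24833 --as helper`; THEOREMS ONLY (no definition, no instance, no notation, no named fact, no `sorry`).

THE MATHEMATICS [Flicker1998UnitaryFL, Prop. 11 p. 87, Prop. 14 p. 94, §6 p. 95; Kottwitz1986BaseChangeUnits, §1 pp. 240–241, §3; Serre1980Trees, II §1.1; Rogawski1990, §4.9
Prop. 4.9.1 (b) p. 55].  `K` complete discretely valued, non-dyadic, residue field of order `q²`, `σ` the unramified involution (`hd`), `U = U(σ, J₀)(K)`, `K₀`, `K₁` the hyperspecial ∕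
special stabilisers, `a, b, c ∈ K¹` norm-one with **`|a − b| = |ϖⁿ|`, `n ≥ 1`, `|a − c| = 1`** (regime R-II, pairing `a ≡ b`; the pairings `a ≡ c`, `b ≡ c` are these theorems after
relabelling), Flicker's literals `t₁ = t_1(a,b,c)`, `t₂ = t_ϖ(a,b,c)`, `t₃ = t_ϖ(a,c,b)`, `t₄ = t_ϖ(b,a,c)`.  ★ T2: `a₁(tᵢ) = 1 + q·m(tᵢ)` (`(c₁, c₂) := (a, c)` resp. `(b, c)`;
`χ_{tᵢ} = (X−a)(X−b)(X−c)`, ★ p09 `flickerLiteral_charpoly_letter_two_congruent`).  (3b)(3d) `t₂, t₄`: the separated eigenvalue `c` sits on an ODD eigenline, so `tᵢ` fixes NO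
hyperspecial vertex (★ CORNER `…corner_eq_phiOne` at `N = ord(x − z) = 0`: `φ₁(·, 0) = 0`), whence `m = 0` and **`a₁ = 1`**.  (3a)(3c) `t₁, t₃`: ★ FILE 1 HEAD with the SHIFT
`Y = t_1(a, b′, c)` resp. `t_ϖ(a, c, b′)`, `b′` the norm-one letter ONE LEVEL DOWN of the sibling's `exists_normOne_shift` (`|a − b′| = |ϖ^{n−1}|`, `|c − b′| = 1`): the three adjoin
letters are the MATRIX identities `Y = γ + λ·X₂`, `γ = Y + μ·(Y − a)(Y − c)`, `X₂ = ν·(Y − a)(Y − c)` (`X₂ = ϖ⁻¹(γ − a)(γ − c) = ϖ⁻¹(b−a)(b−c)·E`, `E` the eigenline idempotent of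
the moved slot; `λ = ϖ(b′−b)∕((b−a)(b−c))`, `μ = (b−b′)∕((b′−a)(b′−c))`, `ν = ϖ⁻¹(b−a)(b−c)∕((b′−a)(b′−c))`, all of valuation `≤ 1`) from the sibling's literal calculus, and
`#Fix_Y(U ⧸ K₀)` is the ★ CORNER unit count at the shifted letters: **`a₁(t₁) = 1 + q·φ₀(n−1, 0, 0)`** (`= 1 + q·Σ_{i ≤ 2⌊(n−1)∕2⌋} qⁱ`, centre hyperspecial) and
**`a₁(t₃) = 1 + q·φ₁(0, n−1)`** (centre special).
HONEST LABEL: compositions (★ T2 ∘ ★ FILE 1 ∘ sibling ∘ ★ CORNER unit counts), unconditional in their letters; count-neutral until the (E1) assembly (row E1.3.5.2.6) consumes them;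
proves no printed statement.  HC_CM is proved only modulo the 7 printed citations (2 remaining named inputs: hLiu418 = stmt-HodgeConjecture-24832, h413 =
stmt-HodgeConjecture-24833) until rung 0 closes.

## References
* [Flicker1998UnitaryFL] Y. Z. Flicker, *Elementary proof of the fundamental lemma for a unitary group*, Canad. J. Math. 50 (1998) 74–98, Prop. 11 p. 87, Prop. 14 p. 94, §6 p. 95.
* [Kottwitz1986BaseChangeUnits] R. E. Kottwitz, *Base change for unit elements of Hecke algebras*, Compositio Math. 60 (1986) 237–250, §1 pp. 240–241, §3.
* [Serre1980Trees] J.-P. Serre, *Trees*, Springer (1980), Ch. II §1.1.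
* [Rogawski1990] J. D. Rogawski, *Automorphic Representations of Unitary Groups in Three Variables*, Ann. of Math. Stud. 123 (1990), §4.9 Prop. 4.9.1 (b) p. 55.
-/

set_option autoImplicit false
-- the mandated namespace repeats the single-problem summit's segment (`HodgeConjecture.HodgeConjecture`)
set_option linter.dupNamespace false

noncomputable section

open MulAction Polynomial Matrix
open Literature.NumberTheory.Automorphic Literature.NumberTheory.Automorphic.HermitianLattice Literature.NumberTheory.Automorphic.UnitaryGroup
open Literature.NumberTheory.Automorphic.UnitaryLatticeTree
open Literature.NumberTheory.Rogawski1990 Literature.NumberTheory.Rogawski1990.Flicker1998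
open scoped Matrix MatrixGroups WithZero Valued

namespace Summit.HodgeConjecture.HodgeConjecture.R90.S6

universe u

variable {K : Type u} [Field K] [Valued K ℤᵐ⁰]

/-! ### §1 (3b)(3d): no fixed hyperspecial vertex ⟹ `a₁ = 1` -/

-- the quotient-action instances `MulAction ↥K₀ (↥K₀ ⧸ I.subgroupOf K₀)` of ★ FILE 1 ∕ ★ T2 exceed the default synthesis budget (same bump as ★ T2)
set_option synthInstance.maxHeartbeats 400000 in
set_option maxHeartbeats 1600000 in
/-- **`a₀(γ) = 0 ⟹ a₁(γ) = 1` in regime R-II** (★ T2's letters VERBATIM): `a₁ = 1 + q·m` and `m ≤ a₀ = #Fix_γ(U ⧸ K₀) = 0`.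
[cite: Kottwitz1986BaseChangeUnits, §1 pp. 240–241] [cite: Rogawski1990, §4.9 Prop. 4.9.1 (b) p. 55] -/
theorem natCard_fixedBy_special_eq_one_of_natCard_fixedBy_eq_zero [ValuativeRel K] [(Valued.v : Valuation K ℤᵐ⁰).Compatible]
    {σ : K →+* K} {ϖ : K} (hd : UnramifiedLocalConjDatum σ ϖ) (hσO : ∀ x : 𝒪[K], σ x ∈ 𝒪[K]) (σk : 𝓀[K] →+* 𝓀[K])
    (hσk : ∀ x : 𝒪[K], IsLocalRing.residue 𝒪[K] ⟨σ x, hσO x⟩ = σk (IsLocalRing.residue 𝒪[K] x))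
    [Fintype 𝓀[K]] {q : ℕ} (hq : Fintype.card 𝓀[K] = q ^ 2) (hfrob : ∀ y, σk y = y ^ q)
    (g₁ : GL (Fin 3) K) (hg₁ : (g₁ : Matrix (Fin 3) (Fin 3) K) = Matrix.diagonal ![(1 : K), 1, ϖ])
    (γ : ↥(unitaryGroupOfForm σ ((StdForm.antidiagonal 3).over K)))
    [Fintype (fixedBy (↥(unitaryGroupOfForm σ ((StdForm.antidiagonal 3).over K)) ⧸
      (glInt 3 K).subgroupOf (unitaryGroupOfForm σ ((StdForm.antidiagonal 3).over K))) γ)]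
    (hK₁fin : (fixedBy (↥(unitaryGroupOfForm σ ((StdForm.antidiagonal 3).over K)) ⧸
      ((glInt 3 K).map (MulAut.conj g₁).toMonoidHom).subgroupOf (unitaryGroupOfForm σ ((StdForm.antidiagonal 3).over K))) γ).Finite)
    (horb : (Set.range fun n : ℕ => ((γ ^ n : ↥(unitaryGroupOfForm σ ((StdForm.antidiagonal 3).over K))) :
      ↥(unitaryGroupOfForm σ ((StdForm.antidiagonal 3).over K)) ⧸ (glInt 3 K).subgroupOf (unitaryGroupOfForm σ ((StdForm.antidiagonal 3).over K)))).Finite)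
    (r : ↥(unitaryGroupOfForm σ ((StdForm.antidiagonal 3).over K)) ⧸ (glInt 3 K).subgroupOf (unitaryGroupOfForm σ ((StdForm.antidiagonal 3).over K)) →
      ↥(unitaryGroupOfForm σ ((StdForm.antidiagonal 3).over K)))
    (hr : Function.RightInverse r QuotientGroup.mk)
    [∀ x : fixedBy (↥(unitaryGroupOfForm σ ((StdForm.antidiagonal 3).over K)) ⧸
        (glInt 3 K).subgroupOf (unitaryGroupOfForm σ ((StdForm.antidiagonal 3).over K))) γ,
      Finite (fixedBy (↥((glInt 3 K).subgroupOf (unitaryGroupOfForm σ ((StdForm.antidiagonal 3).over K))) ⧸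
        (((glInt 3 K).subgroupOf (unitaryGroupOfForm σ ((StdForm.antidiagonal 3).over K)) ⊓
          ((glInt 3 K).map (MulAut.conj g₁).toMonoidHom).subgroupOf (unitaryGroupOfForm σ ((StdForm.antidiagonal 3).over K))).subgroupOf
          ((glInt 3 K).subgroupOf (unitaryGroupOfForm σ ((StdForm.antidiagonal 3).over K)))))
        (⟨(r x.1)⁻¹ * γ * r x.1, inv_mul_mul_mem_of_smul_eq r hr γ x.2⟩ :
          ↥((glInt 3 K).subgroupOf (unitaryGroupOfForm σ ((StdForm.antidiagonal 3).over K)))))]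
    {c₁ c₂ : K} (hc₁ : Valued.v c₁ = 1) (hsep : Valued.v (c₁ - c₂) = 1) (hu₁ : Valued.v (σ c₁ * c₁ - 1) < 1) (hu₂ : Valued.v (σ c₂ * c₂ - 1) < 1)
    (hχ : ∀ i, Valued.v (((((γ : ↥(unitaryGroupOfForm σ ((StdForm.antidiagonal 3).over K))) : GL (Fin 3) K) : Matrix (Fin 3) (Fin 3) K).charpoly -
      (X - C c₁) ^ 2 * (X - C c₂)).coeff i) < 1)
    (h0 : Nat.card (fixedBy (↥(unitaryGroupOfForm σ ((StdForm.antidiagonal 3).over K)) ⧸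
      (glInt 3 K).subgroupOf (unitaryGroupOfForm σ ((StdForm.antidiagonal 3).over K))) γ) = 0) :
    Nat.card (fixedBy (↥(unitaryGroupOfForm σ ((StdForm.antidiagonal 3).over K)) ⧸
        ((glInt 3 K).map (MulAut.conj g₁).toMonoidHom).subgroupOf (unitaryGroupOfForm σ ((StdForm.antidiagonal 3).over K))) γ) = 1 := by
  rw [natCard_fixedBy_special_eq_one_add_mul_of_charpoly_two_congruent hd hσO σk hσk hq hfrob g₁ hg₁ γ hK₁fin horb r hr hc₁ hsep hu₁ hu₂ hχ]
  have hE : IsEmpty (fixedBy (↥(unitaryGroupOfForm σ ((StdForm.antidiagonal 3).over K)) ⧸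
      (glInt 3 K).subgroupOf (unitaryGroupOfForm σ ((StdForm.antidiagonal 3).over K))) γ) := by
    rcases Nat.card_eq_zero.1 h0 with hE | hInf
    · exact hE
    · exact absurd (Finite.of_fintype _) hInf.not_finite
  rw [Nat.card_of_isEmpty, mul_zero, add_zero]

/-! ### §2 The four values -/

section Values

variable [ValuativeRel K] [(Valued.v : Valuation K ℤᵐ⁰).Compatible] [IsDiscreteValuationRing 𝒪[K]] [IsAdicComplete (IsLocalRing.maximalIdeal 𝒪[K]) 𝒪[K]]

-- the quotient-action instances `MulAction ↥K₀ (↥K₀ ⧸ I.subgroupOf K₀)` of ★ FILE 1 ∕ ★ T2 exceed the default synthesis budget (same bump as ★ T2); the ★ CORNER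
-- engines themselves run at `synthInstance.maxHeartbeats 200000`
set_option synthInstance.maxHeartbeats 400000 in
set_option maxHeartbeats 1600000 in
/-- **(3a) `a₁(t₁) = 1 + q·φ₀(n−1, 0, 0)`** — the fixed special count of `t₁ = t_1(a,b,c)` in regime R-II (`|a − b| = |ϖⁿ|`, `n ≥ 1`, `|a − c| = 1`), in ★ T2's letters
(residual ∕ fixed-point binders VERBATIM) + ★ CORNER's frame letters `hy`, `ha₀`: ★ FILE 1 HEAD at `(c₁, c₂) := (a, c)` with the shift `Y = t_1(a, b′, c)` one level down, whose
fixed hyperspecial count is ★ CORNER `…corner_eq_phiZero` at `(N₁, N₂, N) = (n−1, 0, 0)` (centre hyperspecial: `φ₀(n−1,0,0) = Σ_{i ≤ 2⌊(n−1)∕2⌋} qⁱ`).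
[cite: Flicker1998UnitaryFL, Prop. 14 p. 94] [cite: Kottwitz1986BaseChangeUnits, §1 pp. 240–241, §3] [cite: Rogawski1990, §4.9 Prop. 4.9.1 (b) p. 55] -/
theorem natCard_fixedBy_special_flickerOne_eq_of_two_congruent
    {σ : K →+* K} {ϖ : K} (hd : LocalConjDatum σ ϖ) (hσO : ∀ y : 𝒪[K], (σ.comp 𝒪[K].subtype) y ∈ 𝒪[K]) (σk : 𝓀[K] →+* 𝓀[K])
    (hσk : ∀ x : 𝒪[K], IsLocalRing.residue 𝒪[K] ⟨σ x, hσO x⟩ = σk (IsLocalRing.residue 𝒪[K] x))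
    [Fintype 𝓀[K]] {q : ℕ} (hq : Fintype.card 𝓀[K] = q ^ 2) (hfrob : ∀ y, σk y = y ^ q)
    (g₁ : GL (Fin 3) K) (hg₁ : (g₁ : Matrix (Fin 3) (Fin 3) K) = Matrix.diagonal ![(1 : K), 1, ϖ])
    (γ : ↥(unitaryGroupOfForm σ ((StdForm.antidiagonal 3).over K)))
    [Fintype (fixedBy (↥(unitaryGroupOfForm σ ((StdForm.antidiagonal 3).over K)) ⧸
      (glInt 3 K).subgroupOf (unitaryGroupOfForm σ ((StdForm.antidiagonal 3).over K))) γ)]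
    (hK₁fin : (fixedBy (↥(unitaryGroupOfForm σ ((StdForm.antidiagonal 3).over K)) ⧸
      ((glInt 3 K).map (MulAut.conj g₁).toMonoidHom).subgroupOf (unitaryGroupOfForm σ ((StdForm.antidiagonal 3).over K))) γ).Finite)
    (horb : (Set.range fun n : ℕ => ((γ ^ n : ↥(unitaryGroupOfForm σ ((StdForm.antidiagonal 3).over K))) :
      ↥(unitaryGroupOfForm σ ((StdForm.antidiagonal 3).over K)) ⧸ (glInt 3 K).subgroupOf (unitaryGroupOfForm σ ((StdForm.antidiagonal 3).over K)))).Finite)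
    (r : ↥(unitaryGroupOfForm σ ((StdForm.antidiagonal 3).over K)) ⧸ (glInt 3 K).subgroupOf (unitaryGroupOfForm σ ((StdForm.antidiagonal 3).over K)) →
      ↥(unitaryGroupOfForm σ ((StdForm.antidiagonal 3).over K)))
    (hr : Function.RightInverse r QuotientGroup.mk)
    [∀ x : fixedBy (↥(unitaryGroupOfForm σ ((StdForm.antidiagonal 3).over K)) ⧸
        (glInt 3 K).subgroupOf (unitaryGroupOfForm σ ((StdForm.antidiagonal 3).over K))) γ,
      Finite (fixedBy (↥((glInt 3 K).subgroupOf (unitaryGroupOfForm σ ((StdForm.antidiagonal 3).over K))) ⧸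
        (((glInt 3 K).subgroupOf (unitaryGroupOfForm σ ((StdForm.antidiagonal 3).over K)) ⊓
          ((glInt 3 K).map (MulAut.conj g₁).toMonoidHom).subgroupOf (unitaryGroupOfForm σ ((StdForm.antidiagonal 3).over K))).subgroupOf
          ((glInt 3 K).subgroupOf (unitaryGroupOfForm σ ((StdForm.antidiagonal 3).over K)))))
        (⟨(r x.1)⁻¹ * γ * r x.1, inv_mul_mul_mem_of_smul_eq r hr γ x.2⟩ :
          ↥((glInt 3 K).subgroupOf (unitaryGroupOfForm σ ((StdForm.antidiagonal 3).over K)))))]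
    {y : K} (hy : y * σ y = -2) {a₀ : 𝒪[K]} (ha₀ : IsUnit (((σ.comp 𝒪[K].subtype).codRestrict 𝒪[K] hσO) a₀ - a₀))
    {e a b c : K} (h2e : 2 * e = 1) (ha : σ a * a = 1) (hb : σ b * b = 1) (hc : σ c * c = 1)
    (hγ : (((γ : ↥(unitaryGroupOfForm σ ((StdForm.antidiagonal 3).over K))) : GL (Fin 3) K) : Matrix (Fin 3) (Fin 3) K) =
      !![e * (a + c), 0, -(e * (a - c)); 0, b, 0; -(e * (a - c)), 0, e * (a + c)])
    {n : ℕ} (hn : 1 ≤ n) (hab : Valued.v (a - b) = Valued.v (ϖ ^ n)) (hac : Valued.v (a - c) = 1) :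
    (Nat.card (fixedBy (↥(unitaryGroupOfForm σ ((StdForm.antidiagonal 3).over K)) ⧸
        ((glInt 3 K).map (MulAut.conj g₁).toMonoidHom).subgroupOf (unitaryGroupOfForm σ ((StdForm.antidiagonal 3).over K))) γ) : ℚ) =
      1 + q * phiZero q (n - 1) 0 0 := by
  have hϖ0 : ϖ ≠ 0 := hd.ϖ_ne_zero
  have hva : Valued.v a = 1 := (flickerLiteral_norm_one_letters σ hd.vσ ha).2
  have hvb : Valued.v b = 1 := (flickerLiteral_norm_one_letters σ hd.vσ hb).2
  have hvc : Valued.v c = 1 := (flickerLiteral_norm_one_letters σ hd.vσ hc).2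
  have hac0 : a ≠ c := fun h => by rw [h, sub_self, map_zero] at hac; exact zero_ne_one hac
  -- the shift letter `b′` and the unit `Y = t_1(a, b′, c)`
  obtain ⟨b', hb', hab', hcb'⟩ := exists_normOne_shift hd hσO ha₀ ha hc hac hn
  have hvb' : Valued.v b' = 1 := (flickerLiteral_norm_one_letters σ hd.vσ hb').2
  obtain ⟨hba0, hbc0, hb'a0, hb'c0, hab1, -, hl, hm, hn'⟩ := shift_scalar_letters hd hn hab hac hab' hcb'
  obtain ⟨Y, hY⟩ := exists_unitary_coe_eq_flickerLiteral_one σ h2e ha hb' hc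
  -- the three adjoin letters
  obtain ⟨hYmem, hγY, hXY⟩ := adjoin_letters_of_shift_mid (ϖ := ϖ) h2e (one_mul (1 : K)) hϖ0 hba0 hbc0 hb'a0 hb'c0 hl hm hn' hva.le hvc.le
    (hγ.trans (flickerLiteral_one_eq e a b c)) (hY.trans (flickerLiteral_one_eq e a b' c))
  -- ★ T2's letters at `(c₁, c₂) := (a, c)`
  have hM : (((γ : ↥(unitaryGroupOfForm σ ((StdForm.antidiagonal 3).over K))) : GL (Fin 3) K) : Matrix (Fin 3) (Fin 3) K).charpoly =
      (X - C a) * (X - C b) * (X - C c) := by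
    rw [hγ, flickerLiteral_one_eq]; exact charpoly_flickerTorusElt h2e (one_mul 1)
  have hχ := fun i => flickerLiteral_charpoly_letter_two_congruent hM hva.le hvc.le hab1 i
  -- ★ FILE 1 HEAD
  have hT := natCard_fixedBy_special_eq_one_add_mul_natCard_fixedBy_of_mem_adjoin hd.toUnramified hσO σk hσk hq hfrob g₁ hg₁ γ hK₁fin horb r hr hva hac
    (flickerLiteral_norm_one_letters σ hd.vσ ha).1 (flickerLiteral_norm_one_letters σ hd.vσ hc).1 hχ Y hYmem hγY hXY
  -- ★ CORNER at `Y`: `#Fix_Y(U ⧸ K₀) = φ₀(n−1, 0, 0)`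
  have hs1 : Valued.v (a + c - 2 * b') ≤ 1 := by
    refine le_trans (Valuation.map_sub _ _ _) (max_le (le_trans (Valuation.map_add _ _ _) (max_le hva.le hvc.le)) ?_)
    rw [map_mul, hd.v2, one_mul]; exact hvb'.le
  obtain ⟨Np, hNp⟩ := exists_v_eq_v_pow_of_ne_zero hd (add_sub_two_mul_ne_zero_of_normOne σ hd ha hb' hc hac0) hs1
  have hfinY : {x : ↥(unitaryGroupOfForm σ ((StdForm.antidiagonal 3).over K)) ⧸ unitaryInt σ ((StdForm.antidiagonal 3).over K) | Y • x = x}.Finite := by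
    rw [unitaryInt_eq_glInt_subgroupOf]
    exact finite_fixedBy_of_mem_adjoin_singleton hd.vσ γ Y hγY (Set.toFinite _)
  have hq' : Nat.card (IsLocalRing.ResidueField 𝒪[K]) = q ^ 2 := by rw [Nat.card_eq_fintype_card, hq]
  have hval := natCard_fixedPoints_unitaryInt_corner_eq_phiZero σ rfl hd hσO hy hq' ha₀ h2e ha hb' hc hY (N := 0)
    (by rw [pow_zero, map_one]; exact hac) hNp hab' (N₂ := 0) (by rw [pow_zero, map_one]; exact hcb') (Or.inr ⟨Nat.zero_le _, Nat.zero_le _⟩) hfinY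
  rw [unitaryInt_eq_glInt_subgroupOf] at hval
  change (Nat.card (fixedBy (↥(unitaryGroupOfForm σ ((StdForm.antidiagonal 3).over K)) ⧸
      (glInt 3 K).subgroupOf (unitaryGroupOfForm σ ((StdForm.antidiagonal 3).over K))) Y) : ℚ) = phiZero q (n - 1) 0 0 at hval
  rw [hT]; push_cast; rw [hval]

set_option synthInstance.maxHeartbeats 400000 in
set_option maxHeartbeats 1600000 in
/-- **(3c) `a₁(t₃) = 1 + q·φ₁(0, n−1)`** — the fixed special count of `t₃ = t_ϖ(a,c,b)` in regime R-II (`|a − b| = |ϖⁿ|`, `n ≥ 1`, `|a − c| = 1`): ★ FILE 1 HEAD at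
`(c₁, c₂) := (a, c)` with the shift `Y = t_ϖ(a, c, b′)`, whose fixed hyperspecial count is ★ CORNER `…corner_eq_phiOne` at `(N₁, N) = (ord(a − c), ord(a − b′)) = (0, n−1)`
(centre special: `φ₁(0, n−1) = Σ_{i < 2⌈(n−1)∕2⌉} qⁱ`); `b` enters only through `|a − b|` (its norm-one letter is not needed here). [cite: Flicker1998UnitaryFL, Prop. 11 p. 87] [cite: Kottwitz1986BaseChangeUnits, §1 pp. 240–241, §3] [cite: Rogawski1990, §4.9 Prop. 4.9.1 (b) p. 55] -/
theorem natCard_fixedBy_special_flickerPi_acb_eq_of_two_congruent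
    {σ : K →+* K} {ϖ : K} (hd : LocalConjDatum σ ϖ) (hσO : ∀ y : 𝒪[K], (σ.comp 𝒪[K].subtype) y ∈ 𝒪[K]) (σk : 𝓀[K] →+* 𝓀[K])
    (hσk : ∀ x : 𝒪[K], IsLocalRing.residue 𝒪[K] ⟨σ x, hσO x⟩ = σk (IsLocalRing.residue 𝒪[K] x))
    [Fintype 𝓀[K]] {q : ℕ} (hq : Fintype.card 𝓀[K] = q ^ 2) (hfrob : ∀ y, σk y = y ^ q)
    (g₁ : GL (Fin 3) K) (hg₁ : (g₁ : Matrix (Fin 3) (Fin 3) K) = Matrix.diagonal ![(1 : K), 1, ϖ])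
    (γ : ↥(unitaryGroupOfForm σ ((StdForm.antidiagonal 3).over K)))
    [Fintype (fixedBy (↥(unitaryGroupOfForm σ ((StdForm.antidiagonal 3).over K)) ⧸
      (glInt 3 K).subgroupOf (unitaryGroupOfForm σ ((StdForm.antidiagonal 3).over K))) γ)]
    (hK₁fin : (fixedBy (↥(unitaryGroupOfForm σ ((StdForm.antidiagonal 3).over K)) ⧸
      ((glInt 3 K).map (MulAut.conj g₁).toMonoidHom).subgroupOf (unitaryGroupOfForm σ ((StdForm.antidiagonal 3).over K))) γ).Finite)
    (horb : (Set.range fun n : ℕ => ((γ ^ n : ↥(unitaryGroupOfForm σ ((StdForm.antidiagonal 3).over K))) :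
      ↥(unitaryGroupOfForm σ ((StdForm.antidiagonal 3).over K)) ⧸ (glInt 3 K).subgroupOf (unitaryGroupOfForm σ ((StdForm.antidiagonal 3).over K)))).Finite)
    (r : ↥(unitaryGroupOfForm σ ((StdForm.antidiagonal 3).over K)) ⧸ (glInt 3 K).subgroupOf (unitaryGroupOfForm σ ((StdForm.antidiagonal 3).over K)) →
      ↥(unitaryGroupOfForm σ ((StdForm.antidiagonal 3).over K)))
    (hr : Function.RightInverse r QuotientGroup.mk)
    [∀ x : fixedBy (↥(unitaryGroupOfForm σ ((StdForm.antidiagonal 3).over K)) ⧸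
        (glInt 3 K).subgroupOf (unitaryGroupOfForm σ ((StdForm.antidiagonal 3).over K))) γ,
      Finite (fixedBy (↥((glInt 3 K).subgroupOf (unitaryGroupOfForm σ ((StdForm.antidiagonal 3).over K))) ⧸
        (((glInt 3 K).subgroupOf (unitaryGroupOfForm σ ((StdForm.antidiagonal 3).over K)) ⊓
          ((glInt 3 K).map (MulAut.conj g₁).toMonoidHom).subgroupOf (unitaryGroupOfForm σ ((StdForm.antidiagonal 3).over K))).subgroupOf
          ((glInt 3 K).subgroupOf (unitaryGroupOfForm σ ((StdForm.antidiagonal 3).over K)))))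
        (⟨(r x.1)⁻¹ * γ * r x.1, inv_mul_mul_mem_of_smul_eq r hr γ x.2⟩ :
          ↥((glInt 3 K).subgroupOf (unitaryGroupOfForm σ ((StdForm.antidiagonal 3).over K)))))]
    {y : K} (hy : y * σ y = -2) {a₀ : 𝒪[K]} (ha₀ : IsUnit (((σ.comp 𝒪[K].subtype).codRestrict 𝒪[K] hσO) a₀ - a₀))
    {e a b c : K} (h2e : 2 * e = 1) (ha : σ a * a = 1) (hc : σ c * c = 1)
    (hγ : (((γ : ↥(unitaryGroupOfForm σ ((StdForm.antidiagonal 3).over K))) : GL (Fin 3) K) : Matrix (Fin 3) (Fin 3) K) =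
      !![e * (a + b), 0, -(e * (a - b) * ϖ); 0, c, 0; -(e * (a - b) * ϖ⁻¹), 0, e * (a + b)])
    {n : ℕ} (hn : 1 ≤ n) (hab : Valued.v (a - b) = Valued.v (ϖ ^ n)) (hac : Valued.v (a - c) = 1) :
    (Nat.card (fixedBy (↥(unitaryGroupOfForm σ ((StdForm.antidiagonal 3).over K)) ⧸
        ((glInt 3 K).map (MulAut.conj g₁).toMonoidHom).subgroupOf (unitaryGroupOfForm σ ((StdForm.antidiagonal 3).over K))) γ) : ℚ) =
      1 + q * phiOne q 0 (n - 1) := by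
  have hϖ0 : ϖ ≠ 0 := hd.ϖ_ne_zero
  have hϖϖ : ϖ * ϖ⁻¹ = 1 := mul_inv_cancel₀ hϖ0
  have hva : Valued.v a = 1 := (flickerLiteral_norm_one_letters σ hd.vσ ha).2
  have hvc : Valued.v c = 1 := (flickerLiteral_norm_one_letters σ hd.vσ hc).2
  -- the shift letter `b′` and the unit `Y = t_ϖ(a, c, b′)`
  obtain ⟨b', hb', hab', hcb'⟩ := exists_normOne_shift hd hσO ha₀ ha hc hac hn
  obtain ⟨hba0, hbc0, hb'a0, hb'c0, hab1, -, hl, hm, hn'⟩ := shift_scalar_letters hd hn hab hac hab' hcb'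
  obtain ⟨Y, hY⟩ := exists_unitary_coe_eq_flickerLiteral_pi σ h2e hϖϖ hd.σϖ ha hc hb'
  -- the three adjoin letters (moved slot `z`)
  obtain ⟨hYmem, hγY, hXY⟩ := adjoin_letters_of_shift_last (ϖ := ϖ) h2e hϖϖ hϖ0 hba0 hbc0 hb'a0 hb'c0 hl hm hn' hva.le hvc.le hγ hY
  -- ★ T2's letters at `(c₁, c₂) := (a, c)`: `χ = (X − a)(X − c)(X − b) = (X − a)(X − b)(X − c)`
  have hM : (((γ : ↥(unitaryGroupOfForm σ ((StdForm.antidiagonal 3).over K))) : GL (Fin 3) K) : Matrix (Fin 3) (Fin 3) K).charpoly =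
      (X - C a) * (X - C b) * (X - C c) := by
    rw [hγ, charpoly_flickerTorusElt h2e hϖϖ]; ring
  have hχ := fun i => flickerLiteral_charpoly_letter_two_congruent hM hva.le hvc.le hab1 i
  -- ★ FILE 1 HEAD
  have hT := natCard_fixedBy_special_eq_one_add_mul_natCard_fixedBy_of_mem_adjoin hd.toUnramified hσO σk hσk hq hfrob g₁ hg₁ γ hK₁fin horb r hr hva hac
    (flickerLiteral_norm_one_letters σ hd.vσ ha).1 (flickerLiteral_norm_one_letters σ hd.vσ hc).1 hχ Y hYmem hγY hXY
  -- ★ CORNER at `Y`: `#Fix_Y(U ⧸ K₀) = φ₁(0, n−1)`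
  have hfinY : {x : ↥(unitaryGroupOfForm σ ((StdForm.antidiagonal 3).over K)) ⧸ unitaryInt σ ((StdForm.antidiagonal 3).over K) | Y • x = x}.Finite := by
    rw [unitaryInt_eq_glInt_subgroupOf]
    exact finite_fixedBy_of_mem_adjoin_singleton hd.vσ γ Y hγY (Set.toFinite _)
  have hq' : Nat.card (IsLocalRing.ResidueField 𝒪[K]) = q ^ 2 := by rw [Nat.card_eq_fintype_card, hq]
  have hval := natCard_fixedPoints_unitaryInt_corner_eq_phiOne σ rfl hd hσO hy hq' ha₀ h2e ha hc hb' hY hab' (N₁ := 0)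
    (by rw [pow_zero, map_one]; exact hac) (N₂ := 0) (by rw [pow_zero, map_one, Valuation.map_sub_swap]; exact hcb') hfinY
  rw [unitaryInt_eq_glInt_subgroupOf] at hval
  change (Nat.card (fixedBy (↥(unitaryGroupOfForm σ ((StdForm.antidiagonal 3).over K)) ⧸
      (glInt 3 K).subgroupOf (unitaryGroupOfForm σ ((StdForm.antidiagonal 3).over K))) Y) : ℚ) = phiOne q 0 (n - 1) at hval
  rw [hT]; push_cast; rw [hval]

set_option synthInstance.maxHeartbeats 400000 in
set_option maxHeartbeats 1600000 in
/-- **(3b) `a₁(t₂) = 1`** — the fixed special count of `t₂ = t_ϖ(a,b,c)` in regime R-II (`|a − b| = |ϖⁿ|`, `n ≥ 1`, `|a − c| = 1`): the separated eigenvalue `c` sits on an odd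
eigenline, so `t₂` fixes no hyperspecial vertex (★ CORNER `…corner_eq_phiOne` at `N = ord(a − c) = 0`: ★ `phiOne_zero`, `φ₁(n, 0) = 0`) and ★ T2 gives `a₁ = 1 + q·m = 1` (`m ≤ a₀ = 0`).
[cite: Flicker1998UnitaryFL, Prop. 11 p. 87] [cite: Kottwitz1986BaseChangeUnits, §1 pp. 240–241] [cite: Rogawski1990, §4.9 Prop. 4.9.1 (b) p. 55] -/
theorem natCard_fixedBy_special_flickerPi_abc_eq_one_of_two_congruent
    {σ : K →+* K} {ϖ : K} (hd : LocalConjDatum σ ϖ) (hσO : ∀ y : 𝒪[K], (σ.comp 𝒪[K].subtype) y ∈ 𝒪[K]) (σk : 𝓀[K] →+* 𝓀[K])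
    (hσk : ∀ x : 𝒪[K], IsLocalRing.residue 𝒪[K] ⟨σ x, hσO x⟩ = σk (IsLocalRing.residue 𝒪[K] x))
    [Fintype 𝓀[K]] {q : ℕ} (hq : Fintype.card 𝓀[K] = q ^ 2) (hfrob : ∀ y, σk y = y ^ q)
    (g₁ : GL (Fin 3) K) (hg₁ : (g₁ : Matrix (Fin 3) (Fin 3) K) = Matrix.diagonal ![(1 : K), 1, ϖ])
    (γ : ↥(unitaryGroupOfForm σ ((StdForm.antidiagonal 3).over K)))
    [Fintype (fixedBy (↥(unitaryGroupOfForm σ ((StdForm.antidiagonal 3).over K)) ⧸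
      (glInt 3 K).subgroupOf (unitaryGroupOfForm σ ((StdForm.antidiagonal 3).over K))) γ)]
    (hK₁fin : (fixedBy (↥(unitaryGroupOfForm σ ((StdForm.antidiagonal 3).over K)) ⧸
      ((glInt 3 K).map (MulAut.conj g₁).toMonoidHom).subgroupOf (unitaryGroupOfForm σ ((StdForm.antidiagonal 3).over K))) γ).Finite)
    (horb : (Set.range fun n : ℕ => ((γ ^ n : ↥(unitaryGroupOfForm σ ((StdForm.antidiagonal 3).over K))) :
      ↥(unitaryGroupOfForm σ ((StdForm.antidiagonal 3).over K)) ⧸ (glInt 3 K).subgroupOf (unitaryGroupOfForm σ ((StdForm.antidiagonal 3).over K)))).Finite)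
    (r : ↥(unitaryGroupOfForm σ ((StdForm.antidiagonal 3).over K)) ⧸ (glInt 3 K).subgroupOf (unitaryGroupOfForm σ ((StdForm.antidiagonal 3).over K)) →
      ↥(unitaryGroupOfForm σ ((StdForm.antidiagonal 3).over K)))
    (hr : Function.RightInverse r QuotientGroup.mk)
    [∀ x : fixedBy (↥(unitaryGroupOfForm σ ((StdForm.antidiagonal 3).over K)) ⧸
        (glInt 3 K).subgroupOf (unitaryGroupOfForm σ ((StdForm.antidiagonal 3).over K))) γ,
      Finite (fixedBy (↥((glInt 3 K).subgroupOf (unitaryGroupOfForm σ ((StdForm.antidiagonal 3).over K))) ⧸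
        (((glInt 3 K).subgroupOf (unitaryGroupOfForm σ ((StdForm.antidiagonal 3).over K)) ⊓
          ((glInt 3 K).map (MulAut.conj g₁).toMonoidHom).subgroupOf (unitaryGroupOfForm σ ((StdForm.antidiagonal 3).over K))).subgroupOf
          ((glInt 3 K).subgroupOf (unitaryGroupOfForm σ ((StdForm.antidiagonal 3).over K)))))
        (⟨(r x.1)⁻¹ * γ * r x.1, inv_mul_mul_mem_of_smul_eq r hr γ x.2⟩ :
          ↥((glInt 3 K).subgroupOf (unitaryGroupOfForm σ ((StdForm.antidiagonal 3).over K)))))]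
    {y : K} (hy : y * σ y = -2) {a₀ : 𝒪[K]} (ha₀ : IsUnit (((σ.comp 𝒪[K].subtype).codRestrict 𝒪[K] hσO) a₀ - a₀))
    {e a b c : K} (h2e : 2 * e = 1) (ha : σ a * a = 1) (hb : σ b * b = 1) (hc : σ c * c = 1)
    (hγ : (((γ : ↥(unitaryGroupOfForm σ ((StdForm.antidiagonal 3).over K))) : GL (Fin 3) K) : Matrix (Fin 3) (Fin 3) K) =
      !![e * (a + c), 0, -(e * (a - c) * ϖ); 0, b, 0; -(e * (a - c) * ϖ⁻¹), 0, e * (a + c)])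
    {n : ℕ} (hn : 1 ≤ n) (hab : Valued.v (a - b) = Valued.v (ϖ ^ n)) (hac : Valued.v (a - c) = 1) :
    Nat.card (fixedBy (↥(unitaryGroupOfForm σ ((StdForm.antidiagonal 3).over K)) ⧸
        ((glInt 3 K).map (MulAut.conj g₁).toMonoidHom).subgroupOf (unitaryGroupOfForm σ ((StdForm.antidiagonal 3).over K))) γ) = 1 := by
  have hϖ0 : ϖ ≠ 0 := hd.ϖ_ne_zero
  have hϖϖ : ϖ * ϖ⁻¹ = 1 := mul_inv_cancel₀ hϖ0
  have hva : Valued.v a = 1 := (flickerLiteral_norm_one_letters σ hd.vσ ha).2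
  have hvc : Valued.v c = 1 := (flickerLiteral_norm_one_letters σ hd.vσ hc).2
  have hab1 : Valued.v (a - b) < 1 := by
    rw [hab, hd.v_pow, ← WithZero.exp_zero, WithZero.exp_lt_exp]; omega
  have hM : (((γ : ↥(unitaryGroupOfForm σ ((StdForm.antidiagonal 3).over K))) : GL (Fin 3) K) : Matrix (Fin 3) (Fin 3) K).charpoly =
      (X - C a) * (X - C b) * (X - C c) := by
    rw [hγ]; exact charpoly_flickerTorusElt h2e hϖϖ
  have hχ := fun i => flickerLiteral_charpoly_letter_two_congruent hM hva.le hvc.le hab1 i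
  -- `a₀(t₂) = φ₁(n, 0) = 0`
  have hfin : {x : ↥(unitaryGroupOfForm σ ((StdForm.antidiagonal 3).over K)) ⧸ unitaryInt σ ((StdForm.antidiagonal 3).over K) | γ • x = x}.Finite := by
    rw [unitaryInt_eq_glInt_subgroupOf]; exact Set.toFinite (fixedBy _ γ)
  have hq' : Nat.card (IsLocalRing.ResidueField 𝒪[K]) = q ^ 2 := by rw [Nat.card_eq_fintype_card, hq]
  have hcb : Valued.v (c - b) = Valued.v (ϖ ^ 0) := by
    have e' : c - b = (a - b) + (c - a) := by ring
    have hca : Valued.v (c - a) = 1 := by rw [Valuation.map_sub_swap]; exact hac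
    rw [pow_zero, map_one, e', Valuation.map_add_eq_of_lt_right _ (by rw [hca]; exact hab1), hca]
  have hval := natCard_fixedPoints_unitaryInt_corner_eq_phiOne σ rfl hd hσO hy hq' ha₀ h2e ha hb hc hγ (N := 0)
    (by rw [pow_zero, map_one]; exact hac) hab hcb hfin
  rw [phiOne_zero, unitaryInt_eq_glInt_subgroupOf] at hval
  change (Nat.card (fixedBy (↥(unitaryGroupOfForm σ ((StdForm.antidiagonal 3).over K)) ⧸
      (glInt 3 K).subgroupOf (unitaryGroupOfForm σ ((StdForm.antidiagonal 3).over K))) γ) : ℚ) = 0 at hval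
  exact natCard_fixedBy_special_eq_one_of_natCard_fixedBy_eq_zero hd.toUnramified hσO σk hσk hq hfrob g₁ hg₁ γ hK₁fin horb r hr hva hac
    (flickerLiteral_norm_one_letters σ hd.vσ ha).1 (flickerLiteral_norm_one_letters σ hd.vσ hc).1 hχ (by exact_mod_cast hval)

set_option synthInstance.maxHeartbeats 400000 in
set_option maxHeartbeats 1600000 in
/-- **(3d) `a₁(t₄) = 1`** — the fixed special count of `t₄ = t_ϖ(b,a,c)` in regime R-II (`|a − b| = |ϖⁿ|`, `n ≥ 1`, `|a − c| = 1`): as for `t₂` (★ T2 at `(c₁, c₂) := (b, c)`,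
★ CORNER `…corner_eq_phiOne` at `N = ord(b − c) = 0`). [cite: Flicker1998UnitaryFL, Prop. 11 p. 87] [cite: Kottwitz1986BaseChangeUnits, §1 pp. 240–241] [cite: Rogawski1990, §4.9 Prop. 4.9.1 (b) p. 55] -/
theorem natCard_fixedBy_special_flickerPi_bac_eq_one_of_two_congruent
    {σ : K →+* K} {ϖ : K} (hd : LocalConjDatum σ ϖ) (hσO : ∀ y : 𝒪[K], (σ.comp 𝒪[K].subtype) y ∈ 𝒪[K]) (σk : 𝓀[K] →+* 𝓀[K])
    (hσk : ∀ x : 𝒪[K], IsLocalRing.residue 𝒪[K] ⟨σ x, hσO x⟩ = σk (IsLocalRing.residue 𝒪[K] x))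
    [Fintype 𝓀[K]] {q : ℕ} (hq : Fintype.card 𝓀[K] = q ^ 2) (hfrob : ∀ y, σk y = y ^ q)
    (g₁ : GL (Fin 3) K) (hg₁ : (g₁ : Matrix (Fin 3) (Fin 3) K) = Matrix.diagonal ![(1 : K), 1, ϖ])
    (γ : ↥(unitaryGroupOfForm σ ((StdForm.antidiagonal 3).over K)))
    [Fintype (fixedBy (↥(unitaryGroupOfForm σ ((StdForm.antidiagonal 3).over K)) ⧸
      (glInt 3 K).subgroupOf (unitaryGroupOfForm σ ((StdForm.antidiagonal 3).over K))) γ)]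
    (hK₁fin : (fixedBy (↥(unitaryGroupOfForm σ ((StdForm.antidiagonal 3).over K)) ⧸
      ((glInt 3 K).map (MulAut.conj g₁).toMonoidHom).subgroupOf (unitaryGroupOfForm σ ((StdForm.antidiagonal 3).over K))) γ).Finite)
    (horb : (Set.range fun n : ℕ => ((γ ^ n : ↥(unitaryGroupOfForm σ ((StdForm.antidiagonal 3).over K))) :
      ↥(unitaryGroupOfForm σ ((StdForm.antidiagonal 3).over K)) ⧸ (glInt 3 K).subgroupOf (unitaryGroupOfForm σ ((StdForm.antidiagonal 3).over K)))).Finite)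
    (r : ↥(unitaryGroupOfForm σ ((StdForm.antidiagonal 3).over K)) ⧸ (glInt 3 K).subgroupOf (unitaryGroupOfForm σ ((StdForm.antidiagonal 3).over K)) →
      ↥(unitaryGroupOfForm σ ((StdForm.antidiagonal 3).over K)))
    (hr : Function.RightInverse r QuotientGroup.mk)
    [∀ x : fixedBy (↥(unitaryGroupOfForm σ ((StdForm.antidiagonal 3).over K)) ⧸
        (glInt 3 K).subgroupOf (unitaryGroupOfForm σ ((StdForm.antidiagonal 3).over K))) γ,
      Finite (fixedBy (↥((glInt 3 K).subgroupOf (unitaryGroupOfForm σ ((StdForm.antidiagonal 3).over K))) ⧸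
        (((glInt 3 K).subgroupOf (unitaryGroupOfForm σ ((StdForm.antidiagonal 3).over K)) ⊓
          ((glInt 3 K).map (MulAut.conj g₁).toMonoidHom).subgroupOf (unitaryGroupOfForm σ ((StdForm.antidiagonal 3).over K))).subgroupOf
          ((glInt 3 K).subgroupOf (unitaryGroupOfForm σ ((StdForm.antidiagonal 3).over K)))))
        (⟨(r x.1)⁻¹ * γ * r x.1, inv_mul_mul_mem_of_smul_eq r hr γ x.2⟩ :
          ↥((glInt 3 K).subgroupOf (unitaryGroupOfForm σ ((StdForm.antidiagonal 3).over K)))))]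
    {y : K} (hy : y * σ y = -2) {a₀ : 𝒪[K]} (ha₀ : IsUnit (((σ.comp 𝒪[K].subtype).codRestrict 𝒪[K] hσO) a₀ - a₀))
    {e a b c : K} (h2e : 2 * e = 1) (ha : σ a * a = 1) (hb : σ b * b = 1) (hc : σ c * c = 1)
    (hγ : (((γ : ↥(unitaryGroupOfForm σ ((StdForm.antidiagonal 3).over K))) : GL (Fin 3) K) : Matrix (Fin 3) (Fin 3) K) =
      !![e * (b + c), 0, -(e * (b - c) * ϖ); 0, a, 0; -(e * (b - c) * ϖ⁻¹), 0, e * (b + c)])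
    {n : ℕ} (hn : 1 ≤ n) (hab : Valued.v (a - b) = Valued.v (ϖ ^ n)) (hac : Valued.v (a - c) = 1) :
    Nat.card (fixedBy (↥(unitaryGroupOfForm σ ((StdForm.antidiagonal 3).over K)) ⧸
        ((glInt 3 K).map (MulAut.conj g₁).toMonoidHom).subgroupOf (unitaryGroupOfForm σ ((StdForm.antidiagonal 3).over K))) γ) = 1 := by
  have hϖ0 : ϖ ≠ 0 := hd.ϖ_ne_zero
  have hϖϖ : ϖ * ϖ⁻¹ = 1 := mul_inv_cancel₀ hϖ0
  have hva : Valued.v a = 1 := (flickerLiteral_norm_one_letters σ hd.vσ ha).2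
  have hvb : Valued.v b = 1 := (flickerLiteral_norm_one_letters σ hd.vσ hb).2
  have hvc : Valued.v c = 1 := (flickerLiteral_norm_one_letters σ hd.vσ hc).2
  have hab1 : Valued.v (a - b) < 1 := by
    rw [hab, hd.v_pow, ← WithZero.exp_zero, WithZero.exp_lt_exp]; omega
  have hba1 : Valued.v (b - a) < 1 := by rw [Valuation.map_sub_swap]; exact hab1
  have hba : Valued.v (b - a) = Valued.v (ϖ ^ n) := by rw [Valuation.map_sub_swap, hab]
  have hbc : Valued.v (b - c) = 1 := by
    have e' : b - c = (a - c) + (b - a) := by ring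
    rw [e', Valuation.map_add_eq_of_lt_left _ (by rw [hac]; exact hba1), hac]
  have hM : (((γ : ↥(unitaryGroupOfForm σ ((StdForm.antidiagonal 3).over K))) : GL (Fin 3) K) : Matrix (Fin 3) (Fin 3) K).charpoly =
      (X - C b) * (X - C a) * (X - C c) := by
    rw [hγ]; exact charpoly_flickerTorusElt h2e hϖϖ
  have hχ := fun i => flickerLiteral_charpoly_letter_two_congruent hM hvb.le hvc.le hba1 i
  -- `a₀(t₄) = φ₁(n, 0) = 0`
  have hfin : {x : ↥(unitaryGroupOfForm σ ((StdForm.antidiagonal 3).over K)) ⧸ unitaryInt σ ((StdForm.antidiagonal 3).over K) | γ • x = x}.Finite := by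
    rw [unitaryInt_eq_glInt_subgroupOf]; exact Set.toFinite (fixedBy _ γ)
  have hq' : Nat.card (IsLocalRing.ResidueField 𝒪[K]) = q ^ 2 := by rw [Nat.card_eq_fintype_card, hq]
  have hca : Valued.v (c - a) = Valued.v (ϖ ^ 0) := by rw [pow_zero, map_one, Valuation.map_sub_swap]; exact hac
  have hval := natCard_fixedPoints_unitaryInt_corner_eq_phiOne σ rfl hd hσO hy hq' ha₀ h2e hb ha hc hγ (N := 0)
    (by rw [pow_zero, map_one]; exact hbc) hba hca hfin
  rw [phiOne_zero, unitaryInt_eq_glInt_subgroupOf] at hval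
  change (Nat.card (fixedBy (↥(unitaryGroupOfForm σ ((StdForm.antidiagonal 3).over K)) ⧸
      (glInt 3 K).subgroupOf (unitaryGroupOfForm σ ((StdForm.antidiagonal 3).over K))) γ) : ℚ) = 0 at hval
  exact natCard_fixedBy_special_eq_one_of_natCard_fixedBy_eq_zero hd.toUnramified hσO σk hσk hq hfrob g₁ hg₁ γ hK₁fin horb r hr hvb hbc
    (flickerLiteral_norm_one_letters σ hd.vσ hb).1 (flickerLiteral_norm_one_letters σ hd.vσ hc).1 hχ (by exact_mod_cast hval)

end Values

end Summit.HodgeConjecture.HodgeConjecture.R90.S6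

end
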